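import Summits.CriticalPhenomena.SAWScalingLimit.Theses.SAWDevelopingMap
import Literature.Probability.RandomPlanarGeometry.HullRestrictionTests
import Literature.Probability.RandomPlanarGeometry.HullSubdomainPullback
import Literature.Probability.RandomPlanarGeometry.ArcHullDomains
import Literature.Probability.RandomPlanarGeometry.EllipseHulls
import Literature.Probability.RandomPlanarGeometry.RestrictionReflection
import Literature.Probability.RandomPlanarGeometry.CaratheodoryHalfPlaneProofs
import Literature.Probability.RandomPlanarGeometry.ConformalMapCaratheodoryProofs
import Literature.Topology.PlaneTopology.JordanCurveProofs

/-!
# Crux `SAWDevelopingMap.ObservableToSLE` (stmt-CriticalPhenomena-10472), line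
`floor-ratio-restriction-bootstrap`, stub `stub_chordalCarrier`: COLLAR DATA — thin half-ellipse
hulls with restriction derivative `→ 1` (first half of the conformal-geometric input of boundary
avoidance)

Landing target:
`Summits/CriticalPhenomena/SAWScalingLimit/Theorems/SAWDevelopingMapObservableToSLEChordalCarrierCollarData.lean`
(`--supports stmt-CriticalPhenomena-10472`).

The reduction `stub_chordalCarrier_reduction` (sibling file `…ChordalCarrierReduction`) derives the
conclusion of the stub from two inputs; this file PROVES the second one from the per-domain form of
the stub's hypothesis `FloorRestrictionLimit` (the same hypothesis shape as in
`stub_restrictionIdentifies`): **if, for every hull subdomain `D' = φ(ℍ ∖ A)` of `(D; a, b)` with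
restriction data `(Φ_A, Φ'_A(0) = d)`, the `hexSAWLaw`-probability that the walk is a `D'`-mesh walk
tends to `d^{5/8}`, then every boundary piece `frontierPiece D k = ∂D ∖ (B(a,1/(k+1)) ∪ B(b,1/(k+1)))`
is covered by two compact sets `ψ[r, R]`, `ψ[-R, -r]` (`ψ` the boundary extension of a chordal
uniformizing map `φ`, `0 < r < R`), each avoided by the closures of a sequence of hull subdomains
whose containment probabilities tend to `1`** (`stub_chordalCarrier_collars`, sequel file
`…ChordalCarrierCollars`).  This file supplies the COLLAR DATA on the half-plane side
(`stub_chordalCarrier_collarData`, `exists_plusData`, `reflect_data`):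

* `isArcHull_ellHull` — the half-ellipse hulls `B(u,v;ρ)` of `EllipseHulls.lean` are smooth hulls
  (`IsArcHull`: `ℍ ∩ ∂B` is the open elliptic arc), so that `exists_isHullSubdomain_of_isArcHull`
  applies to them; their restriction maps `ellConf` have `Φ'_B(0) = ellDeriv u v ρ → 1` as the
  ellipse flattens (`exists_flattening`: admissible `ρ_j ↑ 1`), and `B(u/2, 2v; ρ)` contains the
  `cl ℍ`-part of an open neighbourhood of `[u, v]` (`mem_ellHull_of_infDist_lt`);
* the reflection `σ(z) = -z̄` carries such data to the negative axis (`reflect_data`: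
  `IsArcHull.image_imagAxisRefl`, `IsRestrictionMap.reflectHull`, `HasRestrictionDeriv.reflectHull`);
* `exists_restrictionData_of_eq` transports restriction data along `φ.pullbackHull D' = J`.
-/

noncomputable section

open scoped Topology NNReal ENNReal
open Filter Set MeasureTheory Metric Complex
open UpperHalfPlane (upperHalfPlaneSet isOpen_upperHalfPlaneSet)
open Literature.Probability.LatticeModels (HexVertex hexGraph hexCenter)
open Literature.Probability.RandomPlanarGeometry
open Literature.Probability.RandomPlanarGeometry.SAW
open Literature.Topology.PlaneTopology (JordanCurveTheorem_holds)

namespace Summit.CriticalPhenomena.SAWScalingLimit.Theorems.ObservableToSLE.FloorRatio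

/-! ### Half-ellipse hulls are smooth hulls; their flattening sequence -/

section Ellipse

variable {u v ρ : ℝ}

/-- **The half-ellipse hull `B(u,v;ρ)` is a smooth hull** (`IsArcHull`): `ℍ ∩ ∂B` is the open
elliptic arc `ellHullArc u v ρ '' (0,1)`, a Jordan arc with distinct real endpoints.
[cite: LawlerSchrammWerner2003Restriction, §2 p. 8 (Smooth hulls)] -/
theorem isArcHull_ellHull (huv : u < v) (h0 : 0 < ρ) (h1 : ρ < 1)
    (hB : ellH u v * jLevel ρ < ellC u v) : IsArcHull (ellHull u v ρ) := by
  refine ⟨(isStarHull_ellHull huv h0 h1 hB).isBoundedHull, ellHullArc u v ρ,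
    (continuous_ellHullArc u v h0).continuousOn, injOn_ellHullArc huv h0,
    ellHullArc_im_eq_zero u v h0 (Or.inl rfl), ellHullArc_im_eq_zero u v h0 (Or.inr rfl),
    fun t ht ↦ ellHullArc_im_pos huv h0 h1 ht, ?_⟩
  have h : ellHull u v ρ ∩ upperHalfPlaneSet = ellRegion u v ρ ∩ upperHalfPlaneSet := by
    ext z
    simp only [ellHull, mem_inter_iff, mem_setOf_eq]
    constructor
    · rintro ⟨⟨hz, -⟩, hH⟩; exact ⟨hz, hH⟩
    · rintro ⟨hz, hH⟩; exact ⟨⟨hz, le_of_lt (show (0 : ℝ) < z.im from hH)⟩, hH⟩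
  rw [inter_comm, frontier_inter_eq_of_inter_eq isOpen_upperHalfPlaneSet h, inter_comm,
    upperHalfPlaneSet_inter_frontier_ellRegion huv h0 h1]

/-- `B(u,v;ρ)` contains the `cl ℍ`-part of the open `h(ρ + ρ⁻¹ - 2)`-neighbourhood of `[u, v]`.
[folklore] -/
theorem mem_ellHull_of_infDist_lt (huv : u < v) {w : ℂ}
    (hw : infDist w (realSeg u v) < ellH u v * (jLevel ρ - 2)) (hw0 : 0 ≤ w.im) :
    w ∈ ellHull u v ρ :=
  ⟨mem_ellRegion_of_infDist_lt huv le_rfl hw, hw0⟩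

/-- **A flattening sequence with admissible parameters.** For `0 < u < v` there are
`ρ_j ∈ (0, 1)`, `ρ_j → 1`, all satisfying the positivity condition `h(ρ_j + ρ_j⁻¹) < c` of
`EllipseHulls.lean` (all real points of `B(u,v;ρ_j)` positive). [folklore] -/
theorem exists_flattening (hu : 0 < u) (huv : u < v) :
    ∃ ρ : ℕ → ℝ, (∀ j, 0 < ρ j) ∧ (∀ j, ρ j < 1) ∧ (∀ j, ellH u v * jLevel (ρ j) < ellC u v) ∧
      Tendsto ρ atTop (𝓝 1) := by
  have hc : ellH u v * 2 < ellC u v := by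
    simp only [ellH, ellC]; linarith
  have hev : ∀ᶠ ρ in 𝓝 (1 : ℝ), ellH u v * jLevel ρ < ellC u v :=
    (tendsto_jLevel_one.const_mul (ellH u v)) (Iio_mem_nhds hc)
  obtain ⟨ρ₁, hB₁, hρ₁⟩ :=
    ((hev.filter_mono (nhdsWithin_le_nhds (s := Iio (1 : ℝ)))).and
      (Ioo_mem_nhdsLT one_pos)).exists
  refine ⟨fun j ↦ 1 - (1 - ρ₁) / ((j : ℝ) + 2), fun j ↦ ?_, fun j ↦ ?_, fun j ↦ ?_, ?_⟩
  · have h2 : (1 - ρ₁) / ((j : ℝ) + 2) ≤ (1 - ρ₁) / 2 :=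
      div_le_div_of_nonneg_left (by linarith [hρ₁.2]) (by norm_num) (by linarith)
    linarith [hρ₁.1]
  · have : 0 < (1 - ρ₁) / ((j : ℝ) + 2) := div_pos (by linarith [hρ₁.2]) (by positivity)
    linarith
  · have hle : ρ₁ ≤ 1 - (1 - ρ₁) / ((j : ℝ) + 2) := by
      have h2 : (1 - ρ₁) / ((j : ℝ) + 2) ≤ (1 - ρ₁) / 1 :=
        div_le_div_of_nonneg_left (by linarith [hρ₁.2]) (by norm_num) (by linarith)
      linarith
    have hlt : 1 - (1 - ρ₁) / ((j : ℝ) + 2) < 1 := by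
      have : 0 < (1 - ρ₁) / ((j : ℝ) + 2) := div_pos (by linarith [hρ₁.2]) (by positivity)
      linarith
    calc ellH u v * jLevel (1 - (1 - ρ₁) / ((j : ℝ) + 2)) ≤ ellH u v * jLevel ρ₁ :=
          mul_le_mul_of_nonneg_left (jLevel_le_jLevel hρ₁.1 hle hlt.le) (ellH_pos huv).le
      _ < ellC u v := hB₁
  · have h1 : Tendsto (fun j : ℕ ↦ (1 - ρ₁) / ((j : ℝ) + 2)) atTop (𝓝 0) := by
      have := (tendsto_one_div_add_atTop_nhds_zero_nat.comp (tendsto_add_atTop_nat 1)).const_mul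
        (1 - ρ₁)
      rw [mul_zero] at this
      refine this.congr fun j ↦ ?_
      simp only [Function.comp_apply, Nat.cast_add, Nat.cast_one]
      ring
    simpa using (tendsto_const_nhds (x := (1 : ℝ))).sub h1

/-- **Plus-side collar data.** For `0 < u < v`: numbers `d_j → 1` and, for each `j`, a smooth
`*`-hull `J ∌ 0` with a restriction map of derivative `d_j` containing the `cl ℍ`-part of an
open neighbourhood `N` of the real segment `[u, v]` (the half-ellipse hulls `B(u/2, 2v; ρ_j)` with
`Φ'_B(0) = ellDeriv → 1`). [cite: LawlerSchrammWerner2003Restriction, §2 p. 8 and (2.4)] -/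
theorem exists_plusData (hu : 0 < u) (huv : u < v) :
    ∃ d : ℕ → ℝ, Tendsto d atTop (𝓝 1) ∧ ∀ j : ℕ, ∃ (J N : Set ℂ)
      (Φ : ConformalEquiv (upperHalfPlaneSet \ J) upperHalfPlaneSet),
      IsArcHull J ∧ (0 : ℂ) ∉ J ∧ IsRestrictionMap J Φ ∧ HasRestrictionDeriv J Φ (d j) ∧
      IsOpen N ∧ (∀ z ∈ N, 0 ≤ z.im → z ∈ J) ∧ (fun x : ℝ ↦ (x : ℂ)) '' Icc u v ⊆ N := by
  have hu' : 0 < u / 2 := by positivity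
  have huv' : u / 2 < 2 * v := by linarith
  obtain ⟨ρ, h0, h1, hB, hρ⟩ := exists_flattening hu' huv'
  refine ⟨fun j ↦ ellDeriv (u / 2) (2 * v) (ρ j), ?_, fun j ↦ ?_⟩
  · have := (tendsto_ellDeriv (u / 2) (2 * v)).comp hρ
    rwa [ellDeriv_one huv' hu'] at this
  · refine ⟨ellHull (u / 2) (2 * v) (ρ j),
      {w | infDist w (realSeg (u / 2) (2 * v)) < ellH (u / 2) (2 * v) * (jLevel (ρ j) - 2)},
      ellConf huv' (h0 j) (h1 j).le (hB j), isArcHull_ellHull huv' (h0 j) (h1 j) (hB j),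
      (isStarHull_ellHull huv' (h0 j) (h1 j) (hB j)).zero_notMem,
      isRestrictionMap_ellConf huv' (h0 j) (h1 j) (hB j),
      hasRestrictionDeriv_ellConf huv' (h0 j) (h1 j) (hB j),
      isOpen_lt (continuous_infDist_pt _) continuous_const,
      fun z hz hz0 ↦ mem_ellHull_of_infDist_lt huv' hz hz0, ?_⟩
    rintro _ ⟨x, hx, rfl⟩
    have hmem : (x : ℂ) ∈ realSeg (u / 2) (2 * v) := by
      rw [ofReal_mem_realSeg, uIcc_of_le huv'.le]
      exact ⟨by linarith [hx.1], by linarith [hx.2]⟩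
    show infDist (x : ℂ) (realSeg (u / 2) (2 * v)) < _
    rw [infDist_zero_of_mem hmem]
    exact mul_pos (ellH_pos huv') (by linarith [two_lt_jLevel (h0 j) (h1 j)])

/-- **Reflected collar data** (negative axis): the reflection `σ(z) = -z̄` carries smooth
`*`-hulls, restriction maps and derivative numbers to themselves
(`IsArcHull.image_imagAxisRefl`, `IsRestrictionMap.reflectHull`, `HasRestrictionDeriv.reflectHull`).
[cite: LawlerSchrammWerner2003Restriction, §2 p. 8 (𝒬₋ = σ(𝒬₊), by symmetry)] -/
theorem reflect_data {d : ℝ} {K : Set ℂ}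
    (h : ∃ (J N : Set ℂ) (Φ : ConformalEquiv (upperHalfPlaneSet \ J) upperHalfPlaneSet),
      IsArcHull J ∧ (0 : ℂ) ∉ J ∧ IsRestrictionMap J Φ ∧ HasRestrictionDeriv J Φ d ∧
      IsOpen N ∧ (∀ z ∈ N, 0 ≤ z.im → z ∈ J) ∧ K ⊆ N) :
    ∃ (J N : Set ℂ) (Φ : ConformalEquiv (upperHalfPlaneSet \ J) upperHalfPlaneSet),
      IsArcHull J ∧ (0 : ℂ) ∉ J ∧ IsRestrictionMap J Φ ∧ HasRestrictionDeriv J Φ d ∧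
      IsOpen N ∧ (∀ z ∈ N, 0 ≤ z.im → z ∈ J) ∧ imagAxisRefl '' K ⊆ N := by
  obtain ⟨J, N, Φ, hJ, h0, hΦ, hd, hN, hNJ, hK⟩ := h
  refine ⟨imagAxisRefl '' J, imagAxisRefl '' N, Φ.reflectHull hJ.1.isClosed,
    hJ.image_imagAxisRefl, ?_, hΦ.reflectHull _, hd.reflectHull _,
    imagAxisRefl.isOpenMap N hN, ?_, image_mono hK⟩
  · rintro ⟨z, hzJ, hz⟩
    have : z = 0 := by rw [← imagAxisRefl_imagAxisRefl z, hz, imagAxisRefl_zero]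
    exact h0 (this ▸ hzJ)
  · rintro _ ⟨w, hw, rfl⟩ him
    exact ⟨w, hNJ w hw (by simpa using him), rfl⟩

/-- The reflection of the real segment `[u, v]` is `[-v, -u]`. [folklore] -/
theorem imagAxisRefl_image_ofReal_Icc (u v : ℝ) :
    imagAxisRefl '' ((fun x : ℝ ↦ (x : ℂ)) '' Icc u v) = (fun x : ℝ ↦ (x : ℂ)) '' Icc (-v) (-u) := by
  ext z
  simp only [mem_image, mem_Icc]
  constructor
  · rintro ⟨_, ⟨x, hx, rfl⟩, rfl⟩
    exact ⟨-x, ⟨by linarith [hx.2], by linarith [hx.1]⟩, by rw [imagAxisRefl_ofReal]⟩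
  · rintro ⟨y, hy, rfl⟩
    exact ⟨(-y : ℝ), ⟨-y, ⟨by linarith [hy.2], by linarith [hy.1]⟩, rfl⟩,
      by rw [imagAxisRefl_ofReal, neg_neg]⟩

end Ellipse

/-! ### Transport of restriction data along an equality of hulls -/

/-- Restriction data `(Φ, d)` of `A` are restriction data of `A' = A` (same underlying map).
[folklore] -/
theorem exists_restrictionData_of_eq {A A' : Set ℂ} (h : A = A')
    {Φ : ConformalEquiv (upperHalfPlaneSet \ A) upperHalfPlaneSet} {d : ℝ}
    (hΦ : IsRestrictionMap A Φ) (hd : HasRestrictionDeriv A Φ d) :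
    ∃ Ψ : ConformalEquiv (upperHalfPlaneSet \ A') upperHalfPlaneSet,
      IsRestrictionMap A' Ψ ∧ HasRestrictionDeriv A' Ψ d := by
  subst h
  exact ⟨Φ, hΦ, hd⟩

/-! ### Registered form: collar data (sub-goal of `stub_chordalCarrier`) -/

/-- **Registered sub-goal `stub_chordalCarrier_collarData`** (crux item stmt-CriticalPhenomena-10472,
line `floor-ratio-restriction-bootstrap`, stub `stub_chordalCarrier`): for `0 < u < v` there are
derivative numbers `d_j → 1` and, for each `j`, a smooth `*`-hull `J ∌ 0` with a restriction map of
derivative `d_j` containing the `cl ℍ`-part of an open neighbourhood of the real segment `[u, v]`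
(`exists_plusData`). [cite: LawlerSchrammWerner2003Restriction, §2 p. 8 and (2.4)] -/
theorem stub_chordalCarrier_collarData :
    ∀ u v : ℝ, 0 < u → u < v →
    ∃ d : ℕ → ℝ, Tendsto d atTop (𝓝 1) ∧ ∀ j : ℕ, ∃ (J N : Set ℂ)
      (Φ : ConformalEquiv (upperHalfPlaneSet \ J) upperHalfPlaneSet),
      IsArcHull J ∧ (0 : ℂ) ∉ J ∧ IsRestrictionMap J Φ ∧ HasRestrictionDeriv J Φ (d j) ∧
      IsOpen N ∧ (∀ z ∈ N, 0 ≤ z.im → z ∈ J) ∧ (fun x : ℝ ↦ (x : ℂ)) '' Icc u v ⊆ N :=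
  fun _ _ hu huv ↦ exists_plusData hu huv

end Summit.CriticalPhenomena.SAWScalingLimit.Theorems.ObservableToSLE.FloorRatio

end
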